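import Summits.AtomisticToContinuum.HydrodynamicLimit.Theorems.InformationPercolationEnginePercolationClosesChaosForecastRobustDefs
import Summits.AtomisticToContinuum.HydrodynamicLimit.Theorems.InformationPercolationEnginePercolationClosesChaosForecastFiltration
import HarnessLib

/-!
# Forecast transfer of the line `equilibrium-forecast-chain-rule` (crux `InformationPercolationEngine.PercolationClosesChaos`,
stmt-AtomisticToContinuum-15178) — skeleton v9, stub W1: the dictionary fact `JngSpec` (`jngSpec_holds`)

Support file (`--supports stmt-AtomisticToContinuum-15178`) proving the registered stub `jngSpec_holds : JngSpec` of skeleton v9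
(lead c4): on the good set `Φ.good` the REVEALED non-good indicator `Jng b ϑs ϑ φs c σ N Φ k q` of `…ForecastRobustDefs` (a
function of the sequential history `seqHist b c σ N Φ k q`, read through the observation-level twins `popO`, `nbhdO`,
`velConfigO`, `DenseO`, `GoodO` of the coarse functionals) IS the indicator of the event "cell `q` is occupied at `kΔ` and is
not a binned-good unit (`GoodUnitB b`)" of the configuration `Φ.flow (kΔ) z`.

The proof is a deterministic dictionary, no measure theory:
* §1 the velocity functionals `kde`, `meanVel`, `temp`, `relEnt`, `inhom` of `…ForecastDefs` read a configuration only through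
  the velocities of the members of the finsets they are given (`kde_congr_vel`, …, `inhom_congr_vel`);
* §2 on the (cell, velocity-bin) data `(cellOf xᵢ, velBin b vᵢ)ᵢ` of a configuration `w` the observation-level twins are the
  configuration-level functionals of the binned configuration `binConfig b w`: `popO = pop`, `nbhdO = nbhd` (`rfl`), the velocity
  functionals of `velConfigO b` and of `binConfig b w` agree (both file member `i` under the bin centre `binCentre b (velBin b vᵢ)`),
  `DenseO ↔ Dense`, and `GoodO ↔ GoodUnitB` (`goodO_iff_goodUnitB`);
* §3 on `Φ.good` the last snapshot `hist k (Fin.last k) = obs k` of the sequential history records exactly these data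
  (`histData_seqHist`, `histData_seqHist_of_good`), whence `jngSpec_holds`;
* §4 (convenience for H3_W / H5_W) `Jng (k, q)` is `σ(seqHist k q)`-measurable (`measurable_Jng_comap`, by `Jng_eq_of_seqHist_eq`
  and `measurable_comap_top_of_imp` of `…ForecastReveal`) and Borel-measurable (`measurable_Jng`, by `comap_seqHist_le` of
  `…ForecastFiltration`).
-/

noncomputable section

open MeasureTheory Set Filter Topology
open scoped ENNReal BigOperators Classical
open Literature.Analysis.FluidPDE Literature.MathematicalPhysics.KineticTheory
open Literature.MathematicalPhysics.KineticTheory.VelocityBlindPlacement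

namespace Summit.AtomisticToContinuum.HydrodynamicLimit.Theorems.EquilibriumForecastLine

/-! ## §1 The velocity functionals read only the velocities of the members -/

section VelOnly

variable {N : ℕ}

/-- The smoothed velocity law of a population depends on the configuration only through the velocities. [folklore] -/
theorem kde_congr_vel (ϑ : ℝ) {w w' : Phase N} (h : ∀ i, (w i).2 = (w' i).2) (P : Finset (Fin (N + 1))) :
    kde ϑ w P = kde ϑ w' P := by
  funext v
  simp only [kde, h]

/-- The mean velocity of a population depends on the configuration only through the velocities. [folklore] -/
theorem meanVel_congr_vel {w w' : Phase N} (h : ∀ i, (w i).2 = (w' i).2) (P : Finset (Fin (N + 1))) :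
    meanVel w P = meanVel w' P := by
  simp only [meanVel, h]

/-- The temperature of a population depends on the configuration only through the velocities. [folklore] -/
theorem temp_congr_vel {w w' : Phase N} (h : ∀ i, (w i).2 = (w' i).2) (P : Finset (Fin (N + 1))) :
    temp w P = temp w' P := by
  simp only [temp, h, meanVel_congr_vel h P]

/-- The smoothed relative entropy of a population depends on the configuration only through the velocities. [folklore] -/
theorem relEnt_congr_vel (ϑ : ℝ) {w w' : Phase N} (h : ∀ i, (w i).2 = (w' i).2) (P : Finset (Fin (N + 1))) :
    relEnt ϑ w P = relEnt ϑ w' P := by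
  simp only [relEnt, kde_congr_vel ϑ h P, meanVel_congr_vel h P, temp_congr_vel h P]

/-- The inhomogeneity of a cell in its neighbourhood depends on the configuration only through the velocities. [folklore] -/
theorem inhom_congr_vel (ϑ : ℝ) {w w' : Phase N} (h : ∀ i, (w i).2 = (w' i).2) (P Q : Finset (Fin (N + 1))) :
    inhom ϑ w P Q = inhom ϑ w' P Q := by
  simp only [inhom, kde_congr_vel ϑ h P, kde_congr_vel ϑ h Q]

end VelOnly

/-! ## §2 The observation-level twins on the data of a configuration -/

section Data

variable {σ : ℝ} {N : ℕ}

/-- On the data `(cellOf xᵢ, velBin b vᵢ)ᵢ` of `w`, the observation-level population of a cell is its population. [folklore] -/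
theorem popO_data (b c σ : ℝ) (N : ℕ) (w : Phase N) (q : Cell) :
    popO (fun i => (cellOf c σ N (w i).1, velBin b (w i).2)) q = pop c σ N w q := rfl

/-- On the data of `w`, the observation-level neighbourhood population of a cell is its neighbourhood population. [folklore] -/
theorem nbhdO_data (b c σ : ℝ) (N : ℕ) (w : Phase N) (q : Cell) :
    nbhdO c σ N (fun i => (cellOf c σ N (w i).1, velBin b (w i).2)) q = nbhd c σ N w q := rfl

/-- On the data of `w`, the velocity carrier `velConfigO b` files every sphere under its bin-centre velocity, as `binConfig b w`
does. [folklore] -/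
theorem velConfigO_data_snd (b c σ : ℝ) (N : ℕ) (w : Phase N) (i : Fin (N + 1)) :
    (velConfigO b (fun i => (cellOf c σ N (w i).1, velBin b (w i).2)) i).2 = (binConfig b w i).2 := rfl

/-- On the data of `w`, the smoothed velocity laws read from `velConfigO b` are those of `binConfig b w`. [folklore] -/
theorem kde_velConfigO_data (ϑ b c σ : ℝ) (N : ℕ) (w : Phase N) (P : Finset (Fin (N + 1))) :
    kde ϑ (velConfigO b (fun i => (cellOf c σ N (w i).1, velBin b (w i).2))) P = kde ϑ (binConfig b w) P :=
  kde_congr_vel ϑ (velConfigO_data_snd b c σ N w) P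

/-- On the data of `w`, the smoothed relative entropies read from `velConfigO b` are those of `binConfig b w`. [folklore] -/
theorem relEnt_velConfigO_data (ϑ b c σ : ℝ) (N : ℕ) (w : Phase N) (P : Finset (Fin (N + 1))) :
    relEnt ϑ (velConfigO b (fun i => (cellOf c σ N (w i).1, velBin b (w i).2))) P = relEnt ϑ (binConfig b w) P :=
  relEnt_congr_vel ϑ (velConfigO_data_snd b c σ N w) P

/-- On the data of `w`, the inhomogeneities read from `velConfigO b` are those of `binConfig b w`. [folklore] -/
theorem inhom_velConfigO_data (ϑ b c σ : ℝ) (N : ℕ) (w : Phase N) (P Q : Finset (Fin (N + 1))) :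
    inhom ϑ (velConfigO b (fun i => (cellOf c σ N (w i).1, velBin b (w i).2))) P Q = inhom ϑ (binConfig b w) P Q :=
  inhom_congr_vel ϑ (velConfigO_data_snd b c σ N w) P Q

/-- On the data of `w`, the observation-level packing predicate is the packing predicate (of `w`, equivalently of
`binConfig b w`). [folklore] -/
theorem denseO_data_iff (b φs c σ : ℝ) (N : ℕ) (w : Phase N) (q : Cell) :
    DenseO φs c σ N (fun i => (cellOf c σ N (w i).1, velBin b (w i).2)) q ↔ Dense φs c σ N w q := Iff.rfl

/-- **The dictionary**: on the data `(cellOf xᵢ, velBin b vᵢ)ᵢ` of a configuration `w`, the observation-level good-unit predicate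
`GoodO b` is the binned good-unit predicate `GoodUnitB b` of `w`. [folklore] -/
theorem goodO_iff_goodUnitB (b ϑs ϑ φs c σ : ℝ) (N : ℕ) (w : Phase N) (q : Cell) :
    GoodO b ϑs ϑ φs c σ N (fun i => (cellOf c σ N (w i).1, velBin b (w i).2)) q ↔ GoodUnitB b ϑs ϑ φs c σ N w q := by
  unfold GoodO GoodUnitB GoodUnit Regular
  rw [denseO_data_iff, popO_data, nbhdO_data, inhom_velConfigO_data, relEnt_velConfigO_data, dense_binConfig_iff,
    pop_binConfig, nbhd_binConfig]

end Data

/-! ## §3 The last snapshot of the sequential history, and the headline -/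

section Reveal

variable {σ : ℝ} {N : ℕ} (Φ : Flow σ N) (b c : ℝ)

/-- The step-start data read from the sequential history of unit `(k, q)` are the (cell, bin) components of the observation
`obs k` (the last snapshot `hist k (Fin.last k)` of the past). [folklore] -/
theorem histData_seqHist (k : ℕ) (q : Cell) (z : Phase N) :
    histData (seqHist b c σ N Φ k q z) = fun i => (obs b c σ N Φ k z i).1 := rfl

/-- On the good set the observation at `kΔ` records the true cell and velocity bin of every sphere. [folklore] -/
theorem obs_fst_of_good {z : Phase N} (hz : z ∈ Φ.good) (k : ℕ) (i : Fin (N + 1)) :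
    (obs b c σ N Φ k z i).1 =
      (cellOf c σ N ((Φ.flow ((k : ℝ) * stepLen c σ N) z) i).1, velBin b ((Φ.flow ((k : ℝ) * stepLen c σ N) z) i).2) := by
  unfold obs
  rw [if_pos hz]

/-- On the good set the step-start data read from `seqHist k q` are the data of the configuration `Φ.flow (kΔ) z`. [folklore] -/
theorem histData_seqHist_of_good {z : Phase N} (hz : z ∈ Φ.good) (k : ℕ) (q : Cell) :
    histData (seqHist b c σ N Φ k q z) = fun i =>
      (cellOf c σ N ((Φ.flow ((k : ℝ) * stepLen c σ N) z) i).1, velBin b ((Φ.flow ((k : ℝ) * stepLen c σ N) z) i).2) := by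
  rw [histData_seqHist]
  funext i
  exact obs_fst_of_good Φ b c hz k i

end Reveal

/-- **Registered stub `jngSpec_holds` (W1 of skeleton v9): the dictionary fact `JngSpec`** — for every flow, parameters, unit
`(k, q)` and good initial datum `z`, the revealed non-good indicator `Jng b ϑs ϑ φs c σ N Φ k q z` equals
`𝟙{pop q ≠ ∅ at kΔ ∧ ¬ GoodUnitB b ϑs ϑ φs (Φ.flow (kΔ) z) q}`: on `Φ.good` the last snapshot of `seqHist k q` records the true
cells and velocity bins (`histData_seqHist_of_good`), on which `popO = pop` (`popO_data`) and `GoodO ↔ GoodUnitB`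
(`goodO_iff_goodUnitB`). Consumed by H3_W (`nonGoodRareW_of`), H5_W (`forecastSplitW_of`) and the composition
`kineticCellChaosLG_of_w`. [folklore] -/
theorem jngSpec_holds : JngSpec := by
  intro σ N Φ b ϑs ϑ φs c k q z hz
  unfold Jng
  rw [histData_seqHist_of_good Φ b c hz k q, popO_data]
  exact if_congr (Iff.rfl.and (goodO_iff_goodUnitB b ϑs ϑ φs c σ N _ q).not) rfl rfl

/-! ## §4 Measurability of the revealed indicator -/

/-- `Jng (k, q)` is `σ(seqHist k q)`-measurable (it factors through the sequential history, `Jng_eq_of_seqHist_eq`): the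
revealedness behind the pull-in `Ĝ (J·X) = J·Ĝ X` of H5_W. [folklore] -/
theorem measurable_Jng_comap {σ : ℝ} {N : ℕ} (Φ : Flow σ N) (b ϑs ϑ φs c : ℝ) (k : ℕ) (q : Cell) :
    Measurable[MeasurableSpace.comap (seqHist b c σ N Φ k q) ⊤] (Jng b ϑs ϑ φs c σ N Φ k q) :=
  measurable_comap_top_of_imp fun _ _ h => Jng_eq_of_seqHist_eq h

/-- `Jng (k, q)` is Borel-measurable (`σ(seqHist k q)` is below the Borel σ-algebra, `comap_seqHist_le`). [folklore] -/
theorem measurable_Jng {σ : ℝ} {N : ℕ} (Φ : Flow σ N) (b ϑs ϑ φs c : ℝ) (k : ℕ) (q : Cell) :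
    Measurable (Jng b ϑs ϑ φs c σ N Φ k q) :=
  (measurable_Jng_comap Φ b ϑs ϑ φs c k q).mono (comap_seqHist_le Φ b c k q) le_rfl

end Summit.AtomisticToContinuum.HydrodynamicLimit.Theorems.EquilibriumForecastLine

end
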